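import Literature.NumberTheory.BeurlingPrimes.LiSeries
import Literature.NumberTheory.BeurlingPrimes.BVContinuation
import HarnessLib

/-!
# `li` as a Stieltjes function: `dli = li′(u) du` and `∫_{[1,x]} u^{−it} dli(u) = ∫₁ˣ li′(u) u^{−it} du`

Topic `Literature/NumberTheory/BeurlingPrimes`. Everything in this file is PROVED.

Broucke–Vindas (2024) apply their Theorem 1.2 — vendored in the tree as the named fact
`BrouckeVindas2024_thm12` over Mathlib's `StieltjesFunction`/`StieltjesFunction.measure`, with the Stieltjes
exponential integral `stieltjesExpSum F x t = ∫_{[1,x]} u^{−it} dF(u)` (`WellBehavedSystems.lean`) — to the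
template `F = li` ("We apply Theorem 1.2 to `F(x) = li(x)`", proof of Theorem 3.1). This file packages the tree's
`li` (`LiSeries.lean`) for that application:

* `liStieltjes : StieltjesFunction ℝ` (`li` is monotone and continuous), with `liStieltjes x = li x`;
* `liStieltjes_measure` — its Lebesgue–Stieltjes measure is `li′(u) du`:
  `liStieltjes.measure = volume.withDensity (ofReal ∘ liDens)` (both give `li b − li a` to `(a, b]`, by the
  fundamental theorem of calculus for `li′ = liDens` on `(1, ∞)` and `li = 0`, `liDens = 0` on `(−∞, 1]`);
* `stieltjesExpSum_liStieltjes` — `∫_{[1,x]} u^{−it} dli(u) = ∫₁ˣ liDens(u) u^{−it} du = BV.tmplSum liDens x t`, the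
  template side of (1.3) in the form used by `BVContinuation.lean`;
* the hypotheses of Theorem 1.2 for `F = li`: `li(1) = 0`, `li ≥ 0`, `li → ∞`, continuity, and the Chebyshev
  bound `li(x) ≤ 2x/log x` (`x ≥ 2`).

## References
* [BrouckeVindas2024] F. Broucke, J. Vindas, *A new generalized prime random approximation procedure and some of
  its applications*, Math. Z. 307 (2024), arXiv:2102.08478, Theorem 1.2 and proof of Theorem 3.1 (read).
-/

noncomputable section

open Complex Set Filter MeasureTheory intervalIntegral
open scoped Topology ENNReal NNReal

namespace Literature.NumberTheory.BeurlingPrimes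

open Literature.Barriers.RiemannHypothesis

/-! ### `li` as a Stieltjes function -/

/-- `li` as a Stieltjes function (monotone, continuous). [cite: BrouckeVindas2024, proof of Theorem 3.1] -/
def liStieltjes : StieltjesFunction ℝ where
  toFun := li
  mono' := li_mono
  right_continuous' _ := continuous_li.continuousWithinAt

/-- `liStieltjes x = li x`. [cite: BrouckeVindas2024, proof of Theorem 3.1] -/
@[simp] theorem liStieltjes_apply (x : ℝ) : liStieltjes x = li x := rfl

/-! ### `liDens` is a bounded density and `∫ₐᵇ liDens = li b − li a` -/

/-- `liDens ≤ 1`. [cite: BrouckeVindas2024, proof of Theorem 3.1] -/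
theorem liDens_le_one (u : ℝ) : liDens u ≤ 1 := by
  by_cases hu : 1 < u
  · exact (liDens_le_poleDensity hu).trans (poleDensity_le_one hu)
  · rw [liDens_of_le_one (not_lt.mp hu)]; exact zero_le_one

/-- `liDens` is integrable on every set of finite measure. [folklore] -/
theorem integrableOn_liDens {s : Set ℝ} (hs : volume s < ∞) : IntegrableOn liDens s := by
  refine Measure.integrableOn_of_bounded (M := 1) hs.ne measurable_liDens.aestronglyMeasurable ?_
  exact Eventually.of_forall fun u ↦ by
    rw [Real.norm_eq_abs, abs_of_nonneg (liDens_nonneg u)]; exact liDens_le_one u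

/-- `liDens` is interval integrable. [folklore] -/
theorem intervalIntegrable_liDens (a b : ℝ) : IntervalIntegrable liDens volume a b :=
  intervalIntegrable_iff.mpr (integrableOn_liDens measure_Ioc_lt_top)

/-- `li` has derivative `liDens u = 0` at every `u < 1` (it vanishes near `u`). [cite: BrouckeVindas2024, proof of Theorem 3.1] -/
theorem hasDerivAt_li_of_lt_one {u : ℝ} (hu : u < 1) : HasDerivAt li (liDens u) u := by
  rw [liDens_of_le_one hu.le]
  have heq : li =ᶠ[𝓝 u] fun _ ↦ (0 : ℝ) := by
    filter_upwards [Iio_mem_nhds hu] with y hy using li_eq_zero_of_le_one (le_of_lt hy)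
  exact (hasDerivAt_const u (0 : ℝ)).congr_of_eventuallyEq heq

/-- **`∫ₐᵇ liDens = li b − li a`** for `a ≤ b` (fundamental theorem of calculus on `[1, ∞)`, where
`li′ = liDens`, and triviality on `(−∞, 1]`, where both vanish; split at `1`). [cite: BrouckeVindas2024, proof of Theorem 3.1] -/
theorem integral_liDens_eq {a b : ℝ} (hab : a ≤ b) : ∫ u in a..b, liDens u = li b - li a := by
  -- the two one-sided cases
  have hleft : ∀ {a b : ℝ}, a ≤ b → b ≤ 1 → ∫ u in a..b, liDens u = li b - li a := by
    intro a b hab hb1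
    rw [li_eq_zero_of_le_one hb1, li_eq_zero_of_le_one (hab.trans hb1), sub_zero]
    rw [intervalIntegral.integral_congr (g := fun _ ↦ (0 : ℝ)) fun u hu ↦ ?_]
    · simp
    · rw [uIcc_of_le hab] at hu
      exact liDens_of_le_one (hu.2.trans hb1)
  have hright : ∀ {a b : ℝ}, a ≤ b → 1 ≤ a → ∫ u in a..b, liDens u = li b - li a := by
    intro a b hab ha1
    exact intervalIntegral.integral_eq_sub_of_hasDerivAt_of_le hab continuous_li.continuousOn
      (fun u hu ↦ hasDerivAt_li (lt_of_le_of_lt ha1 hu.1)) (intervalIntegrable_liDens a b)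
  -- split at `c = max a (min 1 b)`
  rcases le_or_gt b 1 with hb1 | hb1
  · exact hleft hab hb1
  rcases le_or_gt 1 a with ha1 | ha1
  · exact hright hab ha1
  · have h1 : ∫ u in a..b, liDens u = (∫ u in a..1, liDens u) + ∫ u in (1:ℝ)..b, liDens u :=
      (intervalIntegral.integral_add_adjacent_intervals (intervalIntegrable_liDens a 1)
        (intervalIntegrable_liDens 1 b)).symm
    rw [h1, hleft ha1.le le_rfl, hright hb1.le le_rfl, li_one]
    rw [li_eq_zero_of_le_one ha1.le]
    ring

/-! ### The Stieltjes measure of `li` -/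

/-- **`dli = liDens(u) du`**: the Lebesgue–Stieltjes measure of `li` is Lebesgue measure with density `liDens`.
[cite: BrouckeVindas2024, proof of Theorem 3.1] -/
theorem liStieltjes_measure : liStieltjes.measure = volume.withDensity (fun u ↦ ENNReal.ofReal (liDens u)) := by
  refine Measure.ext_of_Ioc _ _ fun a b hab ↦ ?_
  rw [StieltjesFunction.measure_Ioc, withDensity_apply _ measurableSet_Ioc, liStieltjes_apply, liStieltjes_apply,
    ← ofReal_integral_eq_lintegral_ofReal (integrableOn_liDens measure_Ioc_lt_top)
      (Eventually.of_forall fun u ↦ liDens_nonneg u),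
    ← intervalIntegral.integral_of_le hab.le, integral_liDens_eq hab.le]

/-- **The template side of (1.3) for `F = li`**: for `x ≥ 1` and real `t`,
`∫_{[1,x]} u^{−it} dli(u) = ∫₁ˣ liDens(u) u^{−it} du = BV.tmplSum liDens x t`. [cite: BrouckeVindas2024, Theorem 1.2 and proof of Theorem 3.1] -/
theorem stieltjesExpSum_liStieltjes {x : ℝ} (hx : 1 ≤ x) (t : ℝ) :
    stieltjesExpSum liStieltjes x t = BV.tmplSum liDens x t := by
  rw [stieltjesExpSum, liStieltjes_measure]
  have hdens : (fun u ↦ ENNReal.ofReal (liDens u)) = fun u ↦ ((Real.toNNReal (liDens u) : ℝ≥0) : ℝ≥0∞) := rfl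
  rw [hdens, setIntegral_withDensity_eq_setIntegral_smul measurable_liDens.real_toNNReal _ measurableSet_Icc,
    integral_Icc_eq_integral_Ioc, BV.tmplSum, intervalIntegral.integral_of_le hx]
  refine setIntegral_congr_fun measurableSet_Ioc fun u _ ↦ ?_
  rw [BV.tmplIntegrand, NNReal.smul_def, Real.coe_toNNReal _ (liDens_nonneg u), Complex.real_smul]

/-! ### The hypotheses of Theorem 1.2 for `F = li` -/

/-- `li(1) = 0`. [cite: BrouckeVindas2024, Theorem 1.2] -/
theorem liStieltjes_one : liStieltjes 1 = 0 := li_one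

/-- `li ≥ 0`. [cite: BrouckeVindas2024, Theorem 1.2] -/
theorem liStieltjes_nonneg (x : ℝ) : 0 ≤ liStieltjes x := li_nonneg x

/-- `li → ∞`. [cite: BrouckeVindas2024, Theorem 1.2] -/
theorem tendsto_liStieltjes_atTop : Tendsto (fun x : ℝ ↦ liStieltjes x) atTop atTop := tendsto_li_atTop

/-- `li` is continuous. [cite: BrouckeVindas2024, Theorem 1.2] -/
theorem continuous_liStieltjes : Continuous fun x : ℝ ↦ liStieltjes x := continuous_li

/-- **The Chebyshev bound** `li(x) ≤ 2x/log x` for `x ≥ 2` ("`li(x) ≤ Li(x) ≤ 2x/log x`").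
[cite: BrouckeVindas2024, proof of Theorem 3.1] -/
theorem liStieltjes_chebyshev : ∃ C : ℝ, ∀ x : ℝ, 2 ≤ x → liStieltjes x ≤ C * x / Real.log x :=
  ⟨2, fun x hx ↦ (li_le_Li (by linarith)).trans (Li_le (by linarith))⟩

end Literature.NumberTheory.BeurlingPrimes
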